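import Summits.AnomalousDissipation.AnomalousDissipation.Theorems.SolenoidalFractalHomogenisationLagrangianStepVmodShortCore
import Summits.AnomalousDissipation.AnomalousDissipation.Theorems.SolenoidalFractalHomogenisationLagrangianStepZ7GlueDefsR
import Literature.Analysis.FluidPDE.PassiveVectorTensorPropagatorEnergy
import HarnessLib

/-!
# K1L_D (stmt-AnomalousDissipation-27980): (V_mod) flat stage, block (ff) — the LONG-WINDOW ROW from the (sf) block: split the window at a
# good time chosen by the energy inequality
(line file of the (V_mod) lane, engine F5′ of the (ff) block; prover ad-k3l-bookkeeping-p1 g9.)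

For fast data `x` and a fast test `ζ` on a window `[s, t]`, `τ = t − s`: by the energy inequality of the cell member
(`IsPropagator.energy_ineq`, Temam III.1.2) there is a time `u ∈ (s, s + τ/2)` at which the orbit `y = U(s,u)x` has enstrophy
`‖∇y‖² ≤ 2‖x‖²/(lo₁τ)` (`exists_good_time`), hence a FAST part of energy `‖y_F‖² ≤ ‖x‖²/(2π²·m·lo₁·τ)`, `m = (n/4)² + 1`
(`norm_sq_high_le_of_eGrad`).  Then `⟪U(s,t)x − T(s,t)x, ζ⟫ = ⟪U(u,t)y_S − T(u,t)y_S, ζ⟫ + ⟪U(u,t)y_F, ζ⟫ − ⟪T(s,t)x, ζ⟫`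
(`T(u,t)y_S ⊥ ζ`: the coarse member keeps the slow support), where the first term is an (sf) pairing on `[u, t]` (slow datum `y_S`, fast test,
`t − u ≥ τ/2`), the second is at most `‖y_F‖‖ζ‖` and the third at most `e^{−4π² lo_T m τ}‖x‖‖ζ‖`; in the saturated currencies of fast data
(`(1 − e^{−8π²lo_T m τ})‖·‖² ≤ q`) this is **`ff_long_pairing_le`**:
`|⟪U x − T x, ζ⟫| ≤ (η/√c₁ + (1/c₁)(1/√(2π² m lo₁ τ) + e^{−4π² lo_T m τ}))·√q_T(x)·√q*_T(ζ)` with `c₁ = 1 − e^{−8π² lo_T m τ}` and `η` the (sf)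
constant on the half-windows.  `sorry`-free; NOT a proof of any block, of the stub, of K1L_D or AD; rung F-D1.A0.
-/

set_option linter.dupNamespace false

noncomputable section

namespace Summit.AnomalousDissipation.AnomalousDissipation.Theorems.SolenoidalFractalHomogenisation.LagrangianStep.VmodFlat

open Literature.Analysis Literature.Analysis.FluidPDE Literature.Analysis.FunctionSpaces
open MeasureTheory Set Filter UnitAddTorus
open scoped ENNReal NNReal InnerProductSpace
open Summit.AnomalousDissipation.AnomalousDissipation.Theorems.SolenoidalFractalHomogenisation.LagrangianStep.CellClauseMod

/-! ## §1 A good time from the energy inequality -/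

/-- The zero class has no gradient. [folklore] -/
theorem eGradNormSq_coe_zero : Torus.eGradNormSq (((0 : V2)) : VF) = 0 := by
  rw [N1Assembly.eGradNormSq_congr_ae_VF (Lp.coeFn_zero (EuclideanSpace ℝ (Fin 3)) 2 volume), Torus.eGradNormSq_eq_tsum]
  have hc : (⇑(EuclideanSpace.complexify (ι := Fin 3)) ∘ (0 : VF)) = (0 : UnitAddTorus (Fin 3) → EuclideanSpace ℂ (Fin 3)) := by
    funext x; simp
  have h : ∀ k : Fin 3 → ℤ, mFourierCoeff (0 : UnitAddTorus (Fin 3) → EuclideanSpace ℂ (Fin 3)) k = 0 := by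
    intro k
    rw [Torus.mFourierCoeff_eq_integral_volume]
    simp
  simp [hc, h]

set_option maxHeartbeats 800000 in
/-- **A time of small enstrophy in the first half of the window.**  For a window propagator `U` (elliptic tensor `NearIso 𝔹 lo′ hi′`,
essentially bounded a.e. solenoidal carrier), `x ∈ V2`, `0 ≤ s`, `0 < τ`, `s + τ ≤ T₀`: there is `r ∈ (0, τ/2)` with
`eGradNormSq (U s (s+r) (P_σ x)) ≤ 2‖x‖²/(lo′·τ)` (energy inequality `2lo′∫₀^τ‖∇w‖² ≤ ‖x‖²` and Chebyshev on `(0, τ/2)`). [folklore] -/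
theorem exists_good_time {T₀ : ℝ} {𝔹 : Torus.Visc4 (Fin 3)} {lo' hi' : ℝ} (h𝔹 : Torus.NearIso 𝔹 lo' hi') (hlo' : 0 < lo')
    {b : ℝ → VF} (hb : MemLp (Torus.stLift b) ∞ (volume.restrict (Ioo 0 T₀ ×ˢ (univ : Set (EuclideanSpace ℝ (Fin 3))))))
    (hbdiv : ∀ᵐ τ ∂(volume.restrict (Ioo (0:ℝ) T₀)), Torus.IsWeaklyDivFree (b τ))
    {U : ℝ → ℝ → (V2 →L[ℝ] V2)} (hU : Torus.IsPropagator T₀ b 𝔹 U) {s τ : ℝ} (hs : 0 ≤ s) (hτ : 0 < τ) (hsτ : s + τ ≤ T₀) (x : V2) :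
    ∃ r ∈ Ioo (0:ℝ) (τ / 2), Torus.eGradNormSq ((U s (s + r) ((Torus.divFreeL2 (Fin 3)).starProjection x) : V2) : VF) ≠ ⊤ ∧
      (Torus.eGradNormSq ((U s (s + r) ((Torus.divFreeL2 (Fin 3)).starProjection x) : V2) : VF)).toReal ≤ 2 * ‖x‖ ^ 2 / (lo' * τ) := by
  set P := (Torus.divFreeL2 (Fin 3)).starProjection with hPdef
  have hsT : s < T₀ := by linarith
  -- the case `P x = 0`
  by_cases hx0 : P x = 0
  · refine ⟨τ / 4, ⟨by positivity, by linarith⟩, ?_, ?_⟩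
    · rw [hx0, map_zero, eGradNormSq_coe_zero]; exact ENNReal.zero_ne_top
    · rw [hx0, map_zero, eGradNormSq_coe_zero, ENNReal.toReal_zero]; positivity
  -- the window solution from `P x` and the energy inequality
  have hy : MemLp ((P x : V2) : VF) 2 volume := Lp.memLp (P x)
  have hydiv : Torus.IsWeaklyDivFree ((P x : V2) : VF) := Torus.isWeaklyDivFree_starProjection x
  set w := Torus.windowSol h𝔹 hlo' hb hbdiv hs hsT hy hydiv with hwdef
  have hw := Torus.windowSol_spec h𝔹 hlo' hb hbdiv hs hsT hy hydiv
  have hE := hU.energy_ineq h𝔹 hlo' hb hbdiv hs hsT (by linarith : s ≤ s + τ) hsτ x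
  rw [add_sub_cancel_left] at hE
  have hrepr := hU.repr s hs hsT _ hy hydiv w hw
  rw [Lp.toLp_coeFn] at hrepr
  -- `∫⁻_{(0,τ)} ‖∇w‖² ≤ ‖x‖²/(2 lo′)`
  set I : ℝ≥0∞ := ∫⁻ r in Ioo (0:ℝ) τ, Torus.eGradNormSq (w r) with hIdef
  have hPn : ‖P x‖ ≤ ‖x‖ := (Torus.divFreeL2 (Fin 3)).norm_starProjection_apply_le x
  have hI : 2 * (ENNReal.ofReal lo' * I) ≤ ENNReal.ofReal (‖x‖ ^ 2) := by
    have h1 : 2 * Torus.eVectorDissipation lo' w 0 τ ≤ ENNReal.ofReal (‖P x‖ ^ 2) := le_trans le_add_self hE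
    have h2 : ENNReal.ofReal (‖P x‖ ^ 2) ≤ ENNReal.ofReal (‖x‖ ^ 2) := ENNReal.ofReal_le_ofReal (pow_le_pow_left₀ (norm_nonneg _) hPn 2)
    exact h1.trans h2
  -- Chebyshev on `(0, τ/2)`: not a.e. above the level `c = 2‖x‖²/(lo′ τ)`
  set c : ℝ≥0∞ := ENNReal.ofReal (2 * ‖x‖ ^ 2 / (lo' * τ)) with hcdef
  have hx_pos : 0 < ‖x‖ := by
    have : P x ≠ 0 := hx0
    have hxne : x ≠ 0 := fun h => this (by rw [h, map_zero])
    exact norm_pos_iff.2 hxne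
  have hnot : ¬ (∀ᵐ r ∂(volume.restrict (Ioo (0:ℝ) (τ / 2))), c < Torus.eGradNormSq (w r)) := by
    intro hall
    have h1 : ∫⁻ _ in Ioo (0:ℝ) (τ / 2), c ≤ ∫⁻ r in Ioo (0:ℝ) (τ / 2), Torus.eGradNormSq (w r) :=
      lintegral_mono_ae (hall.mono fun r hr => hr.le)
    rw [setLIntegral_const, Real.volume_Ioo, sub_zero] at h1
    have h2 : ∫⁻ r in Ioo (0:ℝ) (τ / 2), Torus.eGradNormSq (w r) ≤ I :=
      lintegral_mono_set (Ioo_subset_Ioo le_rfl (by linarith))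
    have h3 : c * ENNReal.ofReal (τ / 2) = ENNReal.ofReal (‖x‖ ^ 2 / lo') := by
      rw [hcdef, ← ENNReal.ofReal_mul (by positivity)]
      congr 1; field_simp
    rw [h3] at h1
    -- `‖x‖²/lo′ ≤ I` and `2 lo′ I ≤ ‖x‖²` contradict `‖x‖ > 0`
    have h4 : ENNReal.ofReal (‖x‖ ^ 2 / lo') ≤ I := h1.trans h2
    have h5 : 2 * (ENNReal.ofReal lo' * ENNReal.ofReal (‖x‖ ^ 2 / lo')) ≤ ENNReal.ofReal (‖x‖ ^ 2) := le_trans (by gcongr) hI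
    have e : ENNReal.ofReal lo' * ENNReal.ofReal (‖x‖ ^ 2 / lo') = ENNReal.ofReal (‖x‖ ^ 2) := by
      rw [← ENNReal.ofReal_mul hlo'.le]; congr 1; field_simp
    rw [e, two_mul] at h5
    have hatop : ENNReal.ofReal (‖x‖ ^ 2) ≠ ⊤ := ENNReal.ofReal_ne_top
    have hle0 : ENNReal.ofReal (‖x‖ ^ 2) ≤ 0 := by
      have := h5.trans_eq (add_zero _).symm
      exact (ENNReal.add_le_add_iff_left hatop).1 this
    have hpos : 0 < ENNReal.ofReal (‖x‖ ^ 2) := ENNReal.ofReal_pos.2 (by positivity)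
    exact absurd hle0 (not_le.2 hpos)
  -- extract a good time where also the representation holds
  have hsub : Ioo (0:ℝ) (τ / 2) ⊆ Ioo 0 (T₀ - s) := Ioo_subset_Ioo le_rfl (by linarith)
  have hgood : ∀ᵐ r ∂(volume.restrict (Ioo (0:ℝ) (τ / 2))),
      r ∈ Ioo (0:ℝ) (τ / 2) ∧ ∃ hτ' : MemLp (w r) 2 volume, hτ'.toLp (w r) = U s (s + r) (P x) := by
    filter_upwards [ae_restrict_mem measurableSet_Ioo, ae_restrict_of_ae_restrict_of_subset hsub hrepr] with r h1 h2
    exact ⟨h1, h2⟩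
  by_contra hne
  simp only [not_exists, not_and, not_le] at hne
  apply hnot
  filter_upwards [hgood] with r hr
  obtain ⟨hrmem, hm, he⟩ := hr
  have hae : w r =ᵐ[volume] ((U s (s + r) (P x) : V2) : VF) := by rw [← he]; exact hm.coeFn_toLp.symm
  have hEq : Torus.eGradNormSq (w r) = Torus.eGradNormSq ((U s (s + r) (P x) : V2) : VF) := N1Assembly.eGradNormSq_congr_ae_VF hae
  rw [hEq]
  by_contra hle
  have hle' : Torus.eGradNormSq ((U s (s + r) (P x) : V2) : VF) ≤ c := not_lt.1 hle
  have htop : Torus.eGradNormSq ((U s (s + r) (P x) : V2) : VF) ≠ ⊤ := ne_top_of_le_ne_top ENNReal.ofReal_ne_top hle'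
  have hreal : (Torus.eGradNormSq ((U s (s + r) (P x) : V2) : VF)).toReal ≤ 2 * ‖x‖ ^ 2 / (lo' * τ) := by
    have := ENNReal.toReal_mono ENNReal.ofReal_ne_top hle'
    rwa [ENNReal.toReal_ofReal (by positivity)] at this
  exact absurd hreal (not_le.2 (hne r hrmem htop))

/-! ## §2 The fast part of a class of finite enstrophy -/

/-- **The high piece is small in energy when the enstrophy is finite**: `((N:ℝ)²+1)·‖xs‖² ≤ ‖∇x‖₂²/(4π²)` for the piece of `x` off the ball
`|k| ≤ N`. [folklore] -/
theorem norm_sq_high_le_of_eGrad {N : ℕ} {x xs : V2} (hfs : ∀ k, fc xs k = if k ∈ Torus.freqBall (d := Fin 3) N then 0 else fc x k)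
    (hx1 : Torus.eGradNormSq (x : VF) ≠ ⊤) :
    (((N : ℝ)) ^ 2 + 1) * ‖xs‖ ^ 2 ≤ (Torus.eGradNormSq (x : VF)).toReal / (4 * Real.pi ^ 2) := by
  have hP := hasSum_norm_sq_fcoeff xs
  have hG := Torus.hasSum_freqNormSq_mul_sq_norm (x : VF) hx1
  have hle : ∀ k : Fin 3 → ℤ, (((N : ℝ)) ^ 2 + 1) * ‖mFourierCoeff (EuclideanSpace.complexify ∘ ⇑xs) k‖ ^ 2 ≤
      Torus.freqNormSq k * ‖mFourierCoeff (EuclideanSpace.complexify ∘ (x : VF)) k‖ ^ 2 := fun k => by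
    rw [show mFourierCoeff (EuclideanSpace.complexify ∘ ⇑xs) k = fc xs k from rfl,
      show mFourierCoeff (EuclideanSpace.complexify ∘ (x : VF)) k = fc x k from rfl, hfs k]
    by_cases hk : k ∈ Torus.freqBall (d := Fin 3) N
    · rw [if_pos hk, norm_zero]; simp only [ne_eq, OfNat.ofNat_ne_zero, not_false_eq_true, zero_pow, mul_zero]
      exact mul_nonneg (Torus.freqNormSq_nonneg k) (sq_nonneg _)
    · rw [if_neg hk]
      exact mul_le_mul_of_nonneg_right (freqNormSq_ge_of_not_mem_freqBall hk) (sq_nonneg _)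
  have h := hasSum_le hle (hP.mul_left _) hG
  exact h

/-! ## §3 The long-window row from the (sf) block -/

set_option maxHeartbeats 1600000 in
/-- **THE LONG-WINDOW ROW OF (ff) FROM (sf).**  Cell member `U` (carrier `b`: essentially bounded, a.e. solenoidal; tensor `NearIso 𝔹₁ lo₁ hi₁`),
coarse member `T` (no drift, `NearIso 𝔹T loT hiT`), both on `[0, T₀]`; `x, ζ ∈ V2` FAST at resolution `n` (`m := (n/4)² + 1`); window
`0 ≤ s < t ≤ T₀`, `τ = t − s`.  ASSUME the (sf) pairing bound on the second half-windows: for every `u ∈ (s, s + τ/2)` and every SLOW solenoidal `y`,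
`|⟪U u t y − T u t y, P_σ ζ⟫| ≤ η·‖y‖·√(lossAdj (T u t) (P_σ ζ))` (`η ≥ 0`).  THEN
`|⟪U s t x − T s t x, ζ⟫| ≤ (η/√c₁ + (1/√(2π²·m·lo₁·τ) + exp(−4π²·loT·m·τ))/c₁)·√(lossFwd (T s t) x)·√(lossAdj (T s t) ζ)`,
`c₁ = 1 − exp(−8π²·loT·m·τ)`. [folklore] -/
theorem ff_long_pairing_le {T₀ : ℝ} {𝔹₁ 𝔹T : Torus.Visc4 (Fin 3)} {lo₁ hi₁ loT hiT : ℝ} (h𝔹₁ : Torus.NearIso 𝔹₁ lo₁ hi₁) (hlo₁ : 0 < lo₁)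
    (h𝔹T : Torus.NearIso 𝔹T loT hiT) (hloT : 0 < loT)
    {b : ℝ → VF} (hb : MemLp (Torus.stLift b) ∞ (volume.restrict (Ioo 0 T₀ ×ˢ (univ : Set (EuclideanSpace ℝ (Fin 3))))))
    (hbdiv : ∀ᵐ τ ∂(volume.restrict (Ioo (0:ℝ) T₀)), Torus.IsWeaklyDivFree (b τ))
    {U T : ℝ → ℝ → (V2 →L[ℝ] V2)} (hU : Torus.IsPropagator T₀ b 𝔹₁ U)
    (hT : Torus.IsPropagator T₀ (fun (_ : ℝ) (_ : UnitAddTorus (Fin 3)) => (0 : EuclideanSpace ℝ (Fin 3))) 𝔹T T)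
    {s t : ℝ} (hs : 0 ≤ s) (hst : s < t) (htT : t ≤ T₀) {n : ℕ} (x ζ : V2) (hx : IsFast n x) (hζ : IsFast n ζ) {η : ℝ} (hη : 0 ≤ η)
    (hsf : ∀ u ∈ Ioo s (s + (t - s) / 2), ∀ y : V2, Torus.IsWeaklyDivFree (y : VF) → IsSlow n y →
      |⟪U u t y - T u t y, (Torus.divFreeL2 (Fin 3)).starProjection ζ⟫_ℝ| ≤
        η * ‖y‖ * Real.sqrt (lossAdj (T u t) ((Torus.divFreeL2 (Fin 3)).starProjection ζ))) :
    |⟪U s t x - T s t x, ζ⟫_ℝ| ≤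
      (η / Real.sqrt (1 - Real.exp (-(8 * Real.pi ^ 2 * loT * ((((n / 4 : ℕ) : ℝ)) ^ 2 + 1) * (t - s)))) +
        (1 / Real.sqrt (2 * Real.pi ^ 2 * ((((n / 4 : ℕ) : ℝ)) ^ 2 + 1) * lo₁ * (t - s)) +
          Real.exp (-(4 * Real.pi ^ 2 * loT * ((((n / 4 : ℕ) : ℝ)) ^ 2 + 1) * (t - s)))) /
          (1 - Real.exp (-(8 * Real.pi ^ 2 * loT * ((((n / 4 : ℕ) : ℝ)) ^ 2 + 1) * (t - s))))) *
      Real.sqrt (lossFwd (T s t) x) * Real.sqrt (lossAdj (T s t) ζ) := by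
  -- abbreviations (all set before the context grows)
  set P := (Torus.divFreeL2 (Fin 3)).starProjection with hPdef
  set m : ℝ := (((n / 4 : ℕ) : ℝ)) ^ 2 + 1 with hmdef
  set τ : ℝ := t - s with hτdef
  set c₁ : ℝ := 1 - Real.exp (-(8 * Real.pi ^ 2 * loT * m * τ)) with hc₁def
  set E : ℝ := Real.exp (-(4 * Real.pi ^ 2 * loT * m * τ)) with hEdef
  set L : ℝ := 1 / Real.sqrt (2 * Real.pi ^ 2 * m * lo₁ * τ) with hLdef
  have hτ : 0 < τ := by rw [hτdef]; linarith
  have hm0 : 0 < m := by rw [hmdef]; positivity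
  have hm1 : 1 ≤ m := by rw [hmdef]; nlinarith [sq_nonneg (((n / 4 : ℕ) : ℝ))]
  have hTn : ∀ y, ‖T s t y‖ ≤ ‖y‖ := hT.norm_le s t
  -- saturation constant
  have hexp_lt : Real.exp (-(8 * Real.pi ^ 2 * loT * m * τ)) < 1 := by
    rw [Real.exp_lt_one_iff]; have : 0 < 8 * Real.pi ^ 2 * loT * m * τ := by positivity
    linarith
  have hc₁0 : 0 < c₁ := by rw [hc₁def]; linarith
  have hc₁1 : c₁ ≤ 1 := by rw [hc₁def]; linarith [Real.exp_pos (-(8 * Real.pi ^ 2 * loT * m * τ))]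
  have hE0 : 0 ≤ E := (Real.exp_pos _).le
  have hL0 : 0 ≤ L := by rw [hLdef]; positivity
  -- ### Leray reduction
  set x' : V2 := P x with hx'def
  set ζ' : V2 := P ζ with hζ'def
  have hx'div : Torus.IsWeaklyDivFree (x' : VF) := Torus.isWeaklyDivFree_starProjection x
  have hζ'div : Torus.IsWeaklyDivFree (ζ' : VF) := Torus.isWeaklyDivFree_starProjection ζ
  have hPfast : ∀ y : V2, IsFast n y → IsFast n (P y) := fun y hy k' hk' => by
    have h := Torus.norm_mFourierCoeff_starProjection_le y k'
    have h0 : ‖fc (P y) k'‖ ≤ 0 := by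
      calc ‖fc (P y) k'‖ ≤ ‖fc y k'‖ := h
        _ = 0 := by rw [hy k' hk', norm_zero]
    exact norm_le_zero_iff.1 h0
  have hx' : IsFast n x' := hPfast x hx
  have hζ' : IsFast n ζ' := hPfast ζ hζ
  have hpair : ⟪U s t x - T s t x, ζ⟫_ℝ = ⟪U s t x' - T s t x', ζ'⟫_ℝ := Z7Glue.pairing_eq_pairing_starProjection hT hU s t x ζ
  have hqP : lossFwd (T s t) x' ≤ lossFwd (T s t) x := Z7Glue.lossFwd_starProjection_le hT s t x
  have hpP : lossAdj (T s t) ζ' ≤ lossAdj (T s t) ζ := Z7Glue.lossAdj_starProjection_le hT s t ζ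
  have hxn : ‖x'‖ ≤ ‖x‖ := (Torus.divFreeL2 (Fin 3)).norm_starProjection_apply_le x
  -- supports of fast classes: `|k|² ≥ m` wherever the coefficient is nonzero
  have hsuppx : ∀ k', fc x' k' ≠ 0 → m ≤ Torus.freqNormSq k' := fun k' hk' => by
    by_cases hkb : k' ∈ Torus.freqBall (d := Fin 3) (n / 4)
    · exact absurd (hx' k' hkb) hk'
    · exact freqNormSq_ge_of_not_mem_freqBall hkb
  have hsuppζ : ∀ k', fc ζ' k' ≠ 0 → m ≤ Torus.freqNormSq k' := fun k' hk' => by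
    by_cases hkb : k' ∈ Torus.freqBall (d := Fin 3) (n / 4)
    · exact absurd (hζ' k' hkb) hk'
    · exact freqNormSq_ge_of_not_mem_freqBall hkb
  -- ### saturated currencies of the fast data on `[s, t]`
  have hqx : c₁ * ‖x'‖ ^ 2 ≤ lossFwd (T s t) x' := by
    have h := lossFwd_ge_of_supp h𝔹T hloT (fun _ _ => rfl) hT hs hst.le htT x' hm0.le hsuppx
    rwa [← hτdef] at h
  have hqζ : c₁ * ‖ζ'‖ ^ 2 ≤ lossAdj (T s t) ζ' := by
    have h := lossAdj_ge_of_supp h𝔹T hloT hT hs hst.le htT ζ' hm0.le hsuppζ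
    rwa [← hτdef] at h
  have hsx : ‖x'‖ ≤ (1 / Real.sqrt c₁) * Real.sqrt (lossFwd (T s t) x) := by
    have h2 := sqrt_le_of_mul_le hc₁0 (hqx.trans hqP)
    rwa [Real.sqrt_sq (norm_nonneg _)] at h2
  have hsζ : ‖ζ'‖ ≤ (1 / Real.sqrt c₁) * Real.sqrt (lossAdj (T s t) ζ) := by
    have h2 := sqrt_le_of_mul_le hc₁0 (hqζ.trans hpP)
    rwa [Real.sqrt_sq (norm_nonneg _)] at h2
  -- ### the good time `u = s + r`
  have hPx' : P x' = x' := by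
    rw [hx'def]; exact (Torus.divFreeL2 (Fin 3)).starProjection_eq_self_iff.2 ((Torus.divFreeL2 (Fin 3)).starProjection_apply_mem x)
  obtain ⟨r, hrmem, hEtop, hEle⟩ := exists_good_time h𝔹₁ hlo₁ hb hbdiv hU hs hτ (by rw [hτdef]; linarith) x'
  rw [← hPdef, hPx'] at hEtop hEle
  set u : ℝ := s + r with hudef
  have hsu : s < u := by rw [hudef]; linarith [hrmem.1]
  have hut : u < t := by rw [hudef]; have := hrmem.2; rw [hτdef] at this; linarith
  have huT : u ≤ T₀ := by linarith
  set y : V2 := U s u x' with hydef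
  have hyE : Torus.eGradNormSq (y : VF) ≠ ⊤ ∧ (Torus.eGradNormSq (y : VF)).toReal ≤ 2 * ‖x'‖ ^ 2 / (lo₁ * τ) := by
    have e : y = U s (s + r) x' := by rw [hydef, hudef]
    rw [e]; exact ⟨hEtop, hEle⟩
  have hydiv : Torus.IsWeaklyDivFree (y : VF) := hU.divFree s u x'
  have hyn : ‖y‖ ≤ ‖x'‖ := hU.norm_le s u x'
  -- split `y` at the slow ball
  obtain ⟨yS, yF, hysum, hfyS, hfyF, -, hydiv'⟩ := exists_ballSplit (n / 4) y
  obtain ⟨hySdiv, hyFdiv⟩ := hydiv' hydiv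
  have hySslow : IsSlow n yS := fun k' hk' => by rw [hfyS k', if_neg hk']
  have hyS_n : ‖yS‖ ≤ ‖y‖ := by
    have h := norm_sq_eq_add hysum hfyS hfyF
    nlinarith [norm_nonneg yS, norm_nonneg y, sq_nonneg ‖yF‖]
  have hyF_n : ‖yF‖ ≤ L * ‖x'‖ := by
    have h1 := norm_sq_high_le_of_eGrad hfyF hyE.1
    rw [← hmdef] at h1
    have h2 : m * ‖yF‖ ^ 2 ≤ 2 * ‖x'‖ ^ 2 / (lo₁ * τ) / (4 * Real.pi ^ 2) := h1.trans (div_le_div_of_nonneg_right hyE.2 (by positivity))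
    have h3 : (2 * Real.pi ^ 2 * m * lo₁ * τ) * ‖yF‖ ^ 2 ≤ ‖x'‖ ^ 2 := by
      have e : 2 * ‖x'‖ ^ 2 / (lo₁ * τ) / (4 * Real.pi ^ 2) = ‖x'‖ ^ 2 / (2 * Real.pi ^ 2 * lo₁ * τ) := by
        field_simp; ring
      rw [e, le_div_iff₀ (by positivity)] at h2
      nlinarith [h2]
    have h4 := sqrt_le_of_mul_le (by positivity : (0:ℝ) < 2 * Real.pi ^ 2 * m * lo₁ * τ) h3
    rwa [Real.sqrt_sq (norm_nonneg _), Real.sqrt_sq (norm_nonneg _), ← hLdef] at h4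
  -- ### the decomposition of the pairing
  have hcomp : U s t x' = U u t y := by rw [hydef, hU.comp s u t hs hsu.le hut.le htT x']
  have e1 : ⟪U s t x' - T s t x', ζ'⟫_ℝ = ⟪U u t yS - T u t yS, ζ'⟫_ℝ + ⟪T u t yS, ζ'⟫_ℝ + ⟪U u t yF, ζ'⟫_ℝ - ⟪T s t x', ζ'⟫_ℝ := by
    rw [hcomp, ← hysum, map_add, inner_sub_left, inner_sub_left, inner_add_left]; ring
  -- `T u t yS ⊥ ζ'` (slow stays slow, `ζ'` is fast)
  have e2 : ⟪T u t yS, ζ'⟫_ℝ = 0 := by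
    refine inner_eq_zero_of_fc_disjoint fun k' => ?_
    by_cases hkb : k' ∈ Torus.freqBall (d := Fin 3) (n / 4)
    · right; exact hζ' k' hkb
    · left; exact fc_apply_eq_zero_of_carrier_zero h𝔹T hloT (fun _ _ => rfl) hT (hs.trans hsu.le) hut.le htT yS hySdiv (hySslow k' hkb)
  -- (1) the (sf) pairing on `[u, t]`
  have hru : u ∈ Ioo s (s + (t - s) / 2) := by
    refine ⟨hsu, ?_⟩
    rw [hudef]; have := hrmem.2; rw [hτdef] at this; linarith
  have h1 : |⟪U u t yS - T u t yS, ζ'⟫_ℝ| ≤ η * ‖x'‖ * Real.sqrt (lossAdj (T s t) ζ') := by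
    have h := hsf u hru yS hySdiv hySslow
    have hcompT : (T u t).comp (T s u) = T s t := ContinuousLinearMap.ext fun z => hT.comp s u t hs hsu.le hut.le htT z
    have hadj : lossAdj (T u t) ζ' ≤ lossAdj (T s t) ζ' := by
      unfold lossAdj
      have := LossCurrency.lossAdj_le_lossAdj_comp (T₂ := T u t) (hT.norm_le s u) ζ'
      rwa [hcompT] at this
    calc |⟪U u t yS - T u t yS, ζ'⟫_ℝ| ≤ η * ‖yS‖ * Real.sqrt (lossAdj (T u t) ζ') := h
      _ ≤ η * ‖x'‖ * Real.sqrt (lossAdj (T s t) ζ') := by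
          gcongr
          exact hyS_n.trans hyn
  -- (2) the fast remainder of the orbit
  have h2 : |⟪U u t yF, ζ'⟫_ℝ| ≤ L * ‖x'‖ * ‖ζ'‖ := by
    refine (abs_real_inner_le_norm _ _).trans ?_
    exact mul_le_mul_of_nonneg_right ((hU.norm_le u t yF).trans hyF_n) (norm_nonneg _)
  -- (3) the coarse member kills fast data
  have h3 : |⟪T s t x', ζ'⟫_ℝ| ≤ E * ‖x'‖ * ‖ζ'‖ := by
    refine (abs_real_inner_le_norm _ _).trans (mul_le_mul_of_nonneg_right ?_ (norm_nonneg _))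
    have h := norm_sq_apply_le_exp_of_supp h𝔹T hloT (fun _ _ => rfl) hT hs hst.le htT x' hm0.le hsuppx
    rw [← hτdef] at h
    have hE2 : Real.exp (-(8 * Real.pi ^ 2 * loT * m * τ)) = E ^ 2 := by
      rw [hEdef, ← Real.exp_nat_mul]; congr 1; push_cast; ring
    rw [hE2, ← mul_pow] at h
    have := Real.sqrt_le_sqrt h
    rwa [Real.sqrt_sq (norm_nonneg _), Real.sqrt_sq (mul_nonneg hE0 (norm_nonneg _))] at this
  -- ### assembling
  rw [hpair, e1, e2, add_zero]
  have hA : 0 ≤ Real.sqrt (lossFwd (T s t) x) := Real.sqrt_nonneg _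
  have hB : 0 ≤ Real.sqrt (lossAdj (T s t) ζ) := Real.sqrt_nonneg _
  have hpζ' : Real.sqrt (lossAdj (T s t) ζ') ≤ Real.sqrt (lossAdj (T s t) ζ) := Real.sqrt_le_sqrt hpP
  have hsc : 0 < Real.sqrt c₁ := Real.sqrt_pos.2 hc₁0
  have hk1 : |⟪U u t yS - T u t yS, ζ'⟫_ℝ| ≤ η / Real.sqrt c₁ * Real.sqrt (lossFwd (T s t) x) * Real.sqrt (lossAdj (T s t) ζ) := by
    refine h1.trans ?_
    calc η * ‖x'‖ * Real.sqrt (lossAdj (T s t) ζ') ≤ η * ((1 / Real.sqrt c₁) * Real.sqrt (lossFwd (T s t) x)) * Real.sqrt (lossAdj (T s t) ζ) := by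
          gcongr
      _ = η / Real.sqrt c₁ * Real.sqrt (lossFwd (T s t) x) * Real.sqrt (lossAdj (T s t) ζ) := by field_simp
  have hk2 : |⟪U u t yF, ζ'⟫_ℝ| ≤ L / c₁ * Real.sqrt (lossFwd (T s t) x) * Real.sqrt (lossAdj (T s t) ζ) := by
    refine h2.trans ?_
    calc L * ‖x'‖ * ‖ζ'‖ ≤ L * ((1 / Real.sqrt c₁) * Real.sqrt (lossFwd (T s t) x)) * ((1 / Real.sqrt c₁) * Real.sqrt (lossAdj (T s t) ζ)) := by
          gcongr
      _ = L / c₁ * Real.sqrt (lossFwd (T s t) x) * Real.sqrt (lossAdj (T s t) ζ) := by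
          have e : (1 / Real.sqrt c₁) * (1 / Real.sqrt c₁) = 1 / c₁ := by
            rw [div_mul_div_comm, one_mul, ← pow_two, Real.sq_sqrt hc₁0.le]
          calc L * ((1 / Real.sqrt c₁) * Real.sqrt (lossFwd (T s t) x)) * ((1 / Real.sqrt c₁) * Real.sqrt (lossAdj (T s t) ζ))
              = L * ((1 / Real.sqrt c₁) * (1 / Real.sqrt c₁)) * Real.sqrt (lossFwd (T s t) x) * Real.sqrt (lossAdj (T s t) ζ) := by ring
            _ = L / c₁ * Real.sqrt (lossFwd (T s t) x) * Real.sqrt (lossAdj (T s t) ζ) := by rw [e]; ring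
  have hk3 : |⟪T s t x', ζ'⟫_ℝ| ≤ E / c₁ * Real.sqrt (lossFwd (T s t) x) * Real.sqrt (lossAdj (T s t) ζ) := by
    refine h3.trans ?_
    calc E * ‖x'‖ * ‖ζ'‖ ≤ E * ((1 / Real.sqrt c₁) * Real.sqrt (lossFwd (T s t) x)) * ((1 / Real.sqrt c₁) * Real.sqrt (lossAdj (T s t) ζ)) := by
          gcongr
      _ = E / c₁ * Real.sqrt (lossFwd (T s t) x) * Real.sqrt (lossAdj (T s t) ζ) := by
          have e : (1 / Real.sqrt c₁) * (1 / Real.sqrt c₁) = 1 / c₁ := by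
            rw [div_mul_div_comm, one_mul, ← pow_two, Real.sq_sqrt hc₁0.le]
          calc E * ((1 / Real.sqrt c₁) * Real.sqrt (lossFwd (T s t) x)) * ((1 / Real.sqrt c₁) * Real.sqrt (lossAdj (T s t) ζ))
              = E * ((1 / Real.sqrt c₁) * (1 / Real.sqrt c₁)) * Real.sqrt (lossFwd (T s t) x) * Real.sqrt (lossAdj (T s t) ζ) := by ring
            _ = E / c₁ * Real.sqrt (lossFwd (T s t) x) * Real.sqrt (lossAdj (T s t) ζ) := by rw [e]; ring
  calc |⟪U u t yS - T u t yS, ζ'⟫_ℝ + ⟪U u t yF, ζ'⟫_ℝ - ⟪T s t x', ζ'⟫_ℝ|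
      ≤ |⟪U u t yS - T u t yS, ζ'⟫_ℝ| + |⟪U u t yF, ζ'⟫_ℝ| + |⟪T s t x', ζ'⟫_ℝ| := by
        refine (abs_sub _ _).trans ?_
        linarith [abs_add_le ⟪U u t yS - T u t yS, ζ'⟫_ℝ ⟪U u t yF, ζ'⟫_ℝ]
    _ ≤ η / Real.sqrt c₁ * Real.sqrt (lossFwd (T s t) x) * Real.sqrt (lossAdj (T s t) ζ) +
        L / c₁ * Real.sqrt (lossFwd (T s t) x) * Real.sqrt (lossAdj (T s t) ζ) +
        E / c₁ * Real.sqrt (lossFwd (T s t) x) * Real.sqrt (lossAdj (T s t) ζ) := add_le_add (add_le_add hk1 hk2) hk3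
    _ = (η / Real.sqrt c₁ + (L + E) / c₁) * Real.sqrt (lossFwd (T s t) x) * Real.sqrt (lossAdj (T s t) ζ) := by ring

end Summit.AnomalousDissipation.AnomalousDissipation.Theorems.SolenoidalFractalHomogenisation.LagrangianStep.VmodFlat

end
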